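import Literature.Barriers.CriticalPhenomena.LaceExpansionIsingRandomWalkBound
import Mathlib.Analysis.SpecialFunctions.Trigonometric.Bounds
import Mathlib.MeasureTheory.Measure.Haar.NormedSpace
import HarnessLib

/-!
# Uniform-in-`L` bounds for the spread-out random walk behind Sakai's Theorem 1.3:
# the infrared bound of the step distribution and `S_1(x) ≤ δ_{0,x} + O(L^{-d})`

Barrier catalogue `Literature/Barriers/CriticalPhenomena/` (D-0021), fifth file of the Ising entry
`LaceExpansionIsingAboveFour` (statement file `LaceExpansionIsingAboveFour.lean`; `…Proofs.lean`,
`…Reduction.lean`; `…Deconvolution.lean`: the decomposition of the named fact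
`SpreadOutIsing.Sakai2007_thm13_spreadOut` — Sakai 2007, Thm. 1.3, spread-out case — into
Liu–Slade's Proposition 1.2 (`LiuSlade2026_prop12_greenBound`), Liu–Slade's Theorem 1.7
(`LiuSlade2026_thm17`) and Sakai's lace expansion with diagrammatic bounds
(`Sakai2007_isingAssumptionH`); `…RandomWalkBound.lean`: the random-walk bound, transience, and the
assembly `Sakai2007_thm13_spreadOut_of_three_facts`). This file works on the first of the three
remaining named facts, the random-walk input

* `LiuSlade2026_prop12_greenBound` — `S_1(x) ≤ δ_{0,x} + K_S L^{-(2-ε)} ⟦x⟧^{-(d-2)}` for `d > 2`,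
  `L ≥ L₀(ε)` (Liu–Slade 2026, Prop. 1.2, (1.10); Hara–van der Hofstad–Slade 2003, Prop. 1.3.1),

whose printed proof (Hara–van der Hofstad–Slade 2003, §6; Liu–Slade 2026, Appendix A) has two
halves: for `|x| ≤ L` the UNIFORM BOUND "`δ_{0,x} ≤ S_μ(x) ≤ δ_{0,x} + O(L^{-d})`, uniform in
`μ ≤ 1` and `x ∈ ℤ^d`" (HHS 2003, §6.1), and for `|x| > L` the Gaussian decay of `S_1`. Both rest
on the INFRARED BOUND of the step distribution, "`1 - D̂(k) ≥ δ₂L²|k|²` (`|k| ≤ L⁻¹`),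
`1 - D̂(k) ≥ δ₃` (`|k| ≥ L⁻¹`)" (HHS 2003, §6.1, quoting van der Hofstad–Slade 2002, Assumption D,
verified there in Appendix A for `D_L(x) = h(x/L)/Σ_x h(x/L)` and `L` large).

## What is PROVED here (everything; no named facts are introduced)

For Sakai's uniformly spread-out step distribution `D(x) = 1{0 < ‖x‖_∞ ≤ L}/N_L` (`soStep`,
`N_L = (2L+1)^d - 1 = soCount`) and its symbol `D̂ = soSymbol` (`…RandomWalkBound.lean`):

* Part 1 — the row sum `G_L(t) = Σ_{m=-L}^{L} cos(mt)` (`dirichletRowSum`, the Dirichlet kernel):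
  `2 sin(t/2) G_L(t) = 2 sin((L+½)t)`, `|G_L(t) sin(t/2)| ≤ 1`, `|G_L| ≤ 2L+1`,
  `Σ_{m=-L}^{L} m² = L(L+1)(2L+1)/3`, Jordan's bound `(2L+1) - G_L(t) ≥ (2/(3π²))(2L+1)L²t²` for
  `L|t| ≤ π`, `|G_L(t)| ≤ (2L+1)/2` for `2π/(2L+1) ≤ |t| ≤ π`, `G_L(t) ≥ 0` for `|t| < 2π/(2L+1)`,
  and the two-sided bound `(2L+1) - |G_L(t)| ≥ (1/16)(2L+1) min(L²t², 1)` (`L ≥ 1`, `|t| ≤ π`);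
* Part 2 — the product formula `Σ_{y ∈ [-L,L]^d} cos(k·y) = Π_j G_L(k_j)` (through
  `Σ_y e^{ik·y} = Π_j Σ_m e^{ik_jm}`), the punctured cube as the neighbourhood of the origin,
  `N_L = (2L+1)^d - 1 ≥ L^d`, and the closed forms `D̂(k) = (Π_j G_L(k_j) - 1)/N_L`,
  `1 - D̂(k) = ((2L+1)^d - Π_j G_L(k_j))/N_L`;
* Part 3 — the **uniform infrared bound** `1 - D̂(k) ≥ (1/16) min(L²‖k‖²_∞, 1)` on `[-π,π]^d` for
  EVERY `d, L ≥ 1` (`infrared_lower_bound`; the printed bounds hold for `L` large with unspecified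
  constants — here the constants are explicit and no largeness is needed), via
  `(2L+1)^d - Π_j G_L(k_j) ≥ (2L+1)^{d-1}((2L+1) - |G_L(k_{j₀})|)` at a coordinate realising `‖k‖_∞`;
* Part 4 — the **uniform bound** `S_1(x) ≤ δ_{0,x} + C_d L^{-d}` for `d ≥ 3`, EVERY `L ≥ 1` and
  every `x` (`soGreen_one_le_delta_add_uniform`, and `soGreen_le_delta_add_uniform` for
  `μ ∈ [0,1]`), along the printed proof: `S_1 = δ + D + Σ_{n≥2} D^{*n}`, `D ≤ N_L⁻¹ ≤ L^{-d}`; the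
  Fourier representation of `D^{*n}` (`convPow_eq_integral`) and `|Σ_{n<M} D̂^{n+2}| ≤ 2D̂²/(1-D̂)`
  bound the tail by `(2π)^{-d}∫ 2D̂²/(1-D̂)`; and `∫_{[-π,π]^d} D̂²/(1-D̂) ≤ 16(2π)^d/N_L + 16 I_d L^{-d}`
  — Parseval `∫ D̂² = (2π)^d D^{*2}(0) ≤ (2π)^d/N_L` for `L‖k‖_∞ ≥ 1`, the infrared bound and the
  scaling `∫ 1{L‖k‖<1}/(L²‖k‖²) dk = L^{-d} I_d`, `I_d = ∫ 1{‖u‖_∞<1}/‖u‖²_∞ du < ∞` (`d ≥ 3`,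
  dominated by `(d/2)/ε(u)` and the tree's `integrable_indicator_inv_dispersion`) for `L‖k‖_∞ < 1`;
* Part 5 — `1 + D̂(k) ≥ 5/16` on `[-π,π]^d` for `d ≥ 2`, `L ≥ 1` (van der Hofstad–Slade's (Dbound3)
  `a_L(k) < 2 - η`, explicit), the `L`-uniform majorant `1/(1 - D̂) ≤ 16 + 8d/ε` and the integrability
  of `1/(1 - D̂)` (`d ≥ 3`), and the **Fourier representation**
  `S_μ(x) = (2π)^{-d}∫_{[-π,π]^d} cos(k·x)/(1 - μD̂(k)) dk` for `d ≥ 3`, `L ≥ 1`, `μ ∈ [0,1]`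
  (`soGreen_eq_integral`; dominated convergence) — the identification of the tree's series
  `S_μ = Σ_n μⁿD^{*n}` (Sakai 2007, (1.19)) with the Fourier integral by which Hara–van der
  Hofstad–Slade (§1.2) and Liu–Slade ((1.7)) define `S_μ`, so that the named facts
  `LiuSlade2026_prop12_greenBound` / `LiuSlade2026_thm17` speak about the sources' object.

What remains for `LiuSlade2026_prop12_greenBound` after this file is its `|x| > L` half, the
Gaussian decay `S_1(x) ≤ K L^{-(2-ε)}|x|^{-(d-2)}` (HHS 2003, Prop. 1.3.1, second display:
`S_1(x) = a_d σ^{-2}(|x|+1)^{2-d} + O((|x|+1)^{-(d-α)})`, proved in §§6.2–6.4; Liu–Slade 2026,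
(1.8)–(1.9)), i.e. the nearest-neighbour Green-function asymptotics and the spread-out comparison
`S_1 = δ + C_1/σ² + O(L^{-1+ε}⟦x⟧^{1-d})`.

## Design choices

* Sup norm `‖k‖_∞` (the norm of `Fin d → ℝ`) throughout, as in van der Hofstad–Slade's Assumption D
  (`‖k‖_∞ ≤ L⁻¹`); Euclidean statements follow from `‖k‖_∞ ≤ |k| ≤ √d ‖k‖_∞`.
* No closed form of the Dirichlet kernel is used beyond the telescoping identity; the near-origin
  regime is Jordan's inequality (Mathlib `Real.cos_le_one_sub_mul_cos_sq`), the far regime the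
  telescoping bound, and the overlap is arranged at `|t| = 2π/(2L+1) ≤ π/L`.
* The constants (`1/16`, `5/16`, `2/(3π²)`, `33 + 32(2π)^{-d} I_d`) are explicit but not optimised.
* Nothing in the four sibling files is restated or modified; `soSymbol`, `convPow_eq_integral`,
  `soSymbol_lt_one`, `summable_convPow`, `abs_geom_sum_le` are reused from `…RandomWalkBound.lean`.

## References

* T. Hara, R. van der Hofstad, G. Slade, *Critical two-point functions and the lace expansion for
  spread-out high-dimensional percolation and related models*, Ann. Probab. 31 (2003) 349–408,
  arXiv:math-ph/0011046: Prop. 1.3.1 (arXiv numbering; the bound `S_μ ≤ δ + O(L^{-2+α}(|x|+1)^{2-d})`),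
  §6 (first display: the uniform bound `δ ≤ S_μ ≤ δ + O(L^{-d})`) and §6.1 (its proof; the infrared
  bounds on `1 - D̂` quoted from [HS01a]; `∫ D̂² = Σ_y D(y)² = O(L^{-d})`) [HaraHofstadSlade2003].
* R. van der Hofstad, G. Slade, *A generalised inductive approach to the lace expansion*, Probab.
  Theory Related Fields 122 (2002) 389–430, arXiv:math/0012026: §1.2, Assumption D (bounds
  `c₁L²k² ≤ a_L(k)` for `‖k‖_∞ ≤ L⁻¹`, `a_L(k) > η` for `‖k‖_∞ ≥ L⁻¹`, `a_L(k) < 2 - η`) and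
  Appendix A (example `D_L = h(x/L)/Σh`) [VanderhofstadSlade2002].
* Y. Liu, G. Slade, *Gaussian deconvolution and the lace expansion for spread-out models*, Ann.
  Inst. H. Poincaré Probab. Statist. (2026), arXiv:2310.07640: Def. 1.1, Prop. 1.2 with (1.9)–(1.10),
  Appendix A; Lemma 3.6, second display (`Â_μ(k) - Â_μ(0) ≳ L²|k|² ∧ 1`, "proved in [HS02]", §6)
  [LiuSlade2026].
* A. Sakai, *Lace expansion for the Ising model*, Comm. Math. Phys. 272 (2007) 283–344,
  arXiv:math-ph/0510093, §1.2 ((1.15): the uniformly spread-out interaction; (1.19): `S_r`) [Sakai2007].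
-/

noncomputable section

namespace Literature.Barriers.CriticalPhenomena.SpreadOutIsing

open _root_.MeasureTheory Filter _root_.Topology Finset Literature.Probability.LatticeModels
open scoped BigOperators

variable {d L : ℕ}

/-! ## Part 1. The Dirichlet kernel of a row of the cube -/

/-- The row sum `G_L(t) = Σ_{m=-L}^{L} cos(m t)` (the Dirichlet kernel `D_L(t)`), the
one-dimensional factor of `Σ_{y ∈ [-L,L]^d} cos(k·y) = Π_j G_L(k_j)`. [folklore] -/
def dirichletRowSum (L : ℕ) (t : ℝ) : ℝ := ∑ m ∈ Finset.Icc (-(L : ℤ)) L, Real.cos (m * t)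

/-- The symmetric integer interval grows by its two endpoints. [folklore] -/
theorem Icc_neg_succ (n : ℕ) :
    Finset.Icc (-((n + 1 : ℕ) : ℤ)) ((n + 1 : ℕ) : ℤ) =
      insert (-((n : ℤ) + 1)) (insert ((n : ℤ) + 1) (Finset.Icc (-(n : ℤ)) n)) := by
  ext m
  simp only [Finset.mem_Icc, Finset.mem_insert, Nat.cast_add, Nat.cast_one]
  omega

/-- Recursion for sums over `{-(n+1), …, n+1}`. [folklore] -/
theorem sum_Icc_neg_succ (f : ℤ → ℝ) (n : ℕ) :
    ∑ m ∈ Finset.Icc (-((n + 1 : ℕ) : ℤ)) ((n + 1 : ℕ) : ℤ), f m =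
      f (-((n : ℤ) + 1)) + f ((n : ℤ) + 1) + ∑ m ∈ Finset.Icc (-(n : ℤ)) n, f m := by
  rw [Icc_neg_succ, Finset.sum_insert, Finset.sum_insert, add_assoc]
  · simp only [Finset.mem_Icc]; omega
  · simp only [Finset.mem_insert, Finset.mem_Icc]; omega

/-- `G_0(t) = 1`. [folklore] -/
@[simp] theorem dirichletRowSum_zero (t : ℝ) : dirichletRowSum 0 t = 1 := by
  simp [dirichletRowSum]

/-- `G_{L+1}(t) = G_L(t) + 2 cos((L+1)t)`. [folklore] -/
theorem dirichletRowSum_succ (L : ℕ) (t : ℝ) :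
    dirichletRowSum (L + 1) t = dirichletRowSum L t + 2 * Real.cos (((L : ℝ) + 1) * t) := by
  rw [dirichletRowSum, sum_Icc_neg_succ, dirichletRowSum]
  push_cast
  rw [show -(((L : ℝ)) + 1) * t = -(((L : ℝ) + 1) * t) by ring, Real.cos_neg]
  ring

/-- **The telescoping identity** `2 sin(t/2) G_L(t) = 2 sin((L + ½) t)`. [folklore] -/
theorem two_mul_sin_mul_dirichletRowSum (L : ℕ) (t : ℝ) :
    2 * Real.sin (t / 2) * dirichletRowSum L t = 2 * Real.sin (((L : ℝ) + 1 / 2) * t) := by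
  induction L with
  | zero =>
    simp only [dirichletRowSum_zero, mul_one, Nat.cast_zero, zero_add]
    rw [show (1 : ℝ) / 2 * t = t / 2 by ring]
  | succ n ih =>
    rw [dirichletRowSum_succ, mul_add, ih]
    have h := Real.sin_sub_sin (((n : ℝ) + 1 + 1 / 2) * t) (((n : ℝ) + 1 / 2) * t)
    have e1 : (((n : ℝ) + 1 + 1 / 2) * t - ((n : ℝ) + 1 / 2) * t) / 2 = t / 2 := by ring
    have e2 : (((n : ℝ) + 1 + 1 / 2) * t + ((n : ℝ) + 1 / 2) * t) / 2 = ((n : ℝ) + 1) * t := by ring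
    rw [e1, e2] at h
    push_cast
    linarith

/-- `|G_L(t)| · |sin(t/2)| ≤ 1`. [folklore] -/
theorem abs_dirichletRowSum_mul_abs_sin_le (L : ℕ) (t : ℝ) :
    |dirichletRowSum L t| * |Real.sin (t / 2)| ≤ 1 := by
  have h := two_mul_sin_mul_dirichletRowSum L t
  have h2 : |Real.sin (t / 2)| * |dirichletRowSum L t| = |Real.sin (((L : ℝ) + 1 / 2) * t)| := by
    rw [← abs_mul]
    congr 1
    linarith
  rw [mul_comm, h2]
  exact Real.abs_sin_le_one _

/-- `G_L` is even. [folklore] -/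
theorem dirichletRowSum_neg (L : ℕ) (t : ℝ) : dirichletRowSum L (-t) = dirichletRowSum L t := by
  unfold dirichletRowSum
  refine Finset.sum_congr rfl fun m _ => ?_
  rw [mul_neg, Real.cos_neg]

/-- `G_L(t) = G_L(|t|)`. [folklore] -/
theorem dirichletRowSum_abs (L : ℕ) (t : ℝ) : dirichletRowSum L |t| = dirichletRowSum L t := by
  rcases abs_choice t with h | h <;> rw [h]
  exact dirichletRowSum_neg L t

/-- `G_L(t) ≤ 2L + 1` termwise, in the form `(2L+1) - G_L(t) = Σ_m (1 - cos(m t)) ≥ 0`. [folklore] -/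
theorem two_mul_add_one_sub_dirichletRowSum (L : ℕ) (t : ℝ) :
    (2 * L + 1 : ℝ) - dirichletRowSum L t =
      ∑ m ∈ Finset.Icc (-(L : ℤ)) L, (1 - Real.cos (m * t)) := by
  rw [Finset.sum_sub_distrib, Finset.sum_const, Int.card_Icc, dirichletRowSum]
  simp only [nsmul_eq_mul, mul_one]
  congr 1
  rw [show (L : ℤ) + 1 - -(L : ℤ) = ((2 * L + 1 : ℕ) : ℤ) by push_cast; ring, Int.toNat_natCast]
  push_cast
  ring

/-- `|G_L(t)| ≤ 2L + 1`. [folklore] -/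
theorem abs_dirichletRowSum_le (L : ℕ) (t : ℝ) : |dirichletRowSum L t| ≤ 2 * L + 1 := by
  unfold dirichletRowSum
  refine (Finset.abs_sum_le_sum_abs _ _).trans ?_
  calc ∑ m ∈ Finset.Icc (-(L : ℤ)) L, |Real.cos (m * t)| ≤ ∑ m ∈ Finset.Icc (-(L : ℤ)) L, (1 : ℝ) :=
        Finset.sum_le_sum fun m _ => Real.abs_cos_le_one _
    _ = 2 * L + 1 := by
        rw [Finset.sum_const, Int.card_Icc, nsmul_eq_mul, mul_one,
          show (L : ℤ) + 1 - -(L : ℤ) = ((2 * L + 1 : ℕ) : ℤ) by push_cast; ring, Int.toNat_natCast]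
        push_cast; ring

/-- `Σ_{m=-L}^{L} m² = L(L+1)(2L+1)/3`. [folklore] -/
theorem sum_Icc_neg_sq (L : ℕ) :
    ∑ m ∈ Finset.Icc (-(L : ℤ)) L, ((m : ℝ)) ^ 2 = (L : ℝ) * (L + 1) * (2 * L + 1) / 3 := by
  induction L with
  | zero => simp
  | succ n ih =>
    rw [sum_Icc_neg_succ (fun m : ℤ => ((m : ℝ)) ^ 2) n, ih]
    push_cast
    ring

/-- **Quadratic lower bound near the origin** (Jordan's inequality `1 - cos u ≥ (2/π²)u²`,
`|u| ≤ π`): for `L|t| ≤ π`, `(2L+1) - G_L(t) ≥ (2/(3π²)) (2L+1) L² t²`. [folklore] -/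
theorem dirichletRowSum_lower_near (L : ℕ) {t : ℝ} (ht : (L : ℝ) * |t| ≤ Real.pi) :
    2 / (3 * Real.pi ^ 2) * (2 * L + 1) * ((L : ℝ) ^ 2 * t ^ 2) ≤
      (2 * L + 1 : ℝ) - dirichletRowSum L t := by
  rw [two_mul_add_one_sub_dirichletRowSum]
  have hterm : ∀ m ∈ Finset.Icc (-(L : ℤ)) L,
      2 / Real.pi ^ 2 * (((m : ℝ)) ^ 2 * t ^ 2) ≤ 1 - Real.cos (m * t) := by
    intro m hm
    rw [Finset.mem_Icc] at hm
    have hmabs : |(m : ℝ)| ≤ L := by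
      rw [← Int.cast_abs]; exact_mod_cast abs_le.2 ⟨hm.1, hm.2⟩
    have hu : |(m : ℝ) * t| ≤ Real.pi := by
      rw [abs_mul]
      calc |(m : ℝ)| * |t| ≤ L * |t| := mul_le_mul_of_nonneg_right hmabs (abs_nonneg t)
        _ ≤ Real.pi := ht
    have h := Real.cos_le_one_sub_mul_cos_sq hu
    rw [mul_pow] at h
    linarith
  calc 2 / (3 * Real.pi ^ 2) * (2 * L + 1) * ((L : ℝ) ^ 2 * t ^ 2)
      ≤ 2 / Real.pi ^ 2 * t ^ 2 * ((L : ℝ) * (L + 1) * (2 * L + 1) / 3) := by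
        have hπ : 0 < Real.pi ^ 2 := by positivity
        have hL : (0 : ℝ) ≤ L := Nat.cast_nonneg L
        have : (L : ℝ) ^ 2 ≤ (L : ℝ) * (L + 1) := by nlinarith
        have ht2 : 0 ≤ t ^ 2 := sq_nonneg t
        calc 2 / (3 * Real.pi ^ 2) * (2 * L + 1) * ((L : ℝ) ^ 2 * t ^ 2)
            = 2 / Real.pi ^ 2 * t ^ 2 * ((L : ℝ) ^ 2 * (2 * L + 1) / 3) := by ring
          _ ≤ 2 / Real.pi ^ 2 * t ^ 2 * ((L : ℝ) * (L + 1) * (2 * L + 1) / 3) := by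
            gcongr
    _ = ∑ m ∈ Finset.Icc (-(L : ℤ)) L, 2 / Real.pi ^ 2 * (((m : ℝ)) ^ 2 * t ^ 2) := by
        rw [← sum_Icc_neg_sq, Finset.mul_sum]
        refine Finset.sum_congr rfl fun m _ => by ring
    _ ≤ ∑ m ∈ Finset.Icc (-(L : ℤ)) L, (1 - Real.cos (m * t)) := Finset.sum_le_sum hterm

/-- **Away from the origin**: for `2π/(2L+1) ≤ |t| ≤ π`, `|G_L(t)| ≤ (2L+1)/2`
(`|G_L(t)| ≤ 1/sin(|t|/2)` and `sin(|t|/2) ≥ |t|/π`). [folklore] -/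
theorem abs_dirichletRowSum_le_half (L : ℕ) {t : ℝ} (hπ : |t| ≤ Real.pi)
    (ht : 2 * Real.pi / (2 * L + 1) ≤ |t|) : |dirichletRowSum L t| ≤ (2 * L + 1) / 2 := by
  have hM : (0 : ℝ) < 2 * L + 1 := by positivity
  have hsin : |t| / Real.pi ≤ Real.sin (|t| / 2) := by
    have h := Real.mul_le_sin (x := |t| / 2) (by positivity) (by linarith)
    calc |t| / Real.pi = 2 / Real.pi * (|t| / 2) := by field_simp
      _ ≤ Real.sin (|t| / 2) := h
  have hsin_pos : 0 < Real.sin (|t| / 2) := by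
    have : 0 < |t| / Real.pi := div_pos (lt_of_lt_of_le (by positivity) ht) Real.pi_pos
    linarith
  have hkey := abs_dirichletRowSum_mul_abs_sin_le L |t|
  rw [dirichletRowSum_abs, abs_of_pos hsin_pos] at hkey
  -- `|G| ≤ 1 / sin(|t|/2) ≤ π/|t| ≤ (2L+1)/2`
  have h1 : |dirichletRowSum L t| ≤ 1 / Real.sin (|t| / 2) := by
    rw [le_div_iff₀ hsin_pos]; exact hkey
  have h2 : 1 / Real.sin (|t| / 2) ≤ Real.pi / |t| := by
    have htpos : 0 < |t| := lt_of_lt_of_le (by positivity) ht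
    rw [div_le_div_iff₀ hsin_pos htpos, one_mul]
    calc |t| = Real.pi * (|t| / Real.pi) := by field_simp
      _ ≤ Real.pi * Real.sin (|t| / 2) := mul_le_mul_of_nonneg_left hsin Real.pi_pos.le
  have h3 : Real.pi / |t| ≤ (2 * L + 1) / 2 := by
    have htpos : 0 < |t| := lt_of_lt_of_le (by positivity) ht
    rw [div_le_div_iff₀ htpos two_pos]
    rw [div_le_iff₀ hM] at ht
    linarith
  exact h1.trans (h2.trans h3)

/-- **Sign near the origin**: for `|t| < 2π/(2L+1)`, `G_L(t) ≥ 0` (`2 sin(|t|/2) G_L = 2 sin((L+½)|t|)`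
with `(L+½)|t| < π`). [folklore] -/
theorem dirichletRowSum_nonneg_near (L : ℕ) {t : ℝ} (ht : |t| < 2 * Real.pi / (2 * L + 1)) :
    0 ≤ dirichletRowSum L t := by
  have hM : (0 : ℝ) < 2 * L + 1 := by positivity
  rcases eq_or_ne t 0 with rfl | ht0
  · unfold dirichletRowSum
    exact Finset.sum_nonneg fun m _ => by simp
  have htpos : 0 < |t| := abs_pos.2 ht0
  rw [lt_div_iff₀ hM] at ht
  have hL0 : (0 : ℝ) ≤ L := Nat.cast_nonneg L
  have hlt : ((L : ℝ) + 1 / 2) * |t| < Real.pi := by nlinarith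
  have hlt2 : |t| / 2 < Real.pi := by nlinarith [Real.pi_pos]
  have hsin_pos : 0 < Real.sin (|t| / 2) := Real.sin_pos_of_pos_of_lt_pi (by positivity) hlt2
  have hsin_nn : 0 ≤ Real.sin (((L : ℝ) + 1 / 2) * |t|) :=
    Real.sin_nonneg_of_nonneg_of_le_pi (by positivity) hlt.le
  have hkey := two_mul_sin_mul_dirichletRowSum L |t|
  rw [dirichletRowSum_abs] at hkey
  by_contra hneg
  rw [not_le] at hneg
  have : 2 * Real.sin (|t| / 2) * dirichletRowSum L t < 0 :=
    mul_neg_of_pos_of_neg (by positivity) hneg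
  linarith

/-- **The two-sided one-dimensional bound**: for `L ≥ 1` and `|t| ≤ π`,
`(2L+1) - |G_L(t)| ≥ (1/16)(2L+1) min(L²t², 1)`. Cases: `|t| ≥ 2π/(2L+1)` (then
`|G_L| ≤ (2L+1)/2`), or `|t| < 2π/(2L+1) ≤ π/L` (then `G_L ≥ 0` and Jordan's bound applies).
[folklore] -/
theorem dirichletRowSum_two_sided (hL : 1 ≤ L) {t : ℝ} (hπ : |t| ≤ Real.pi) :
    1 / 16 * (2 * L + 1) * min ((L : ℝ) ^ 2 * t ^ 2) 1 ≤ (2 * L + 1 : ℝ) - |dirichletRowSum L t| := by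
  have hM : (0 : ℝ) < 2 * L + 1 := by positivity
  have hL1 : (1 : ℝ) ≤ L := by exact_mod_cast hL
  have hmin1 : min ((L : ℝ) ^ 2 * t ^ 2) 1 ≤ 1 := min_le_right _ _
  have hmin0 : 0 ≤ min ((L : ℝ) ^ 2 * t ^ 2) 1 := le_min (by positivity) zero_le_one
  by_cases hfar : 2 * Real.pi / (2 * L + 1) ≤ |t|
  · have h := abs_dirichletRowSum_le_half L hπ hfar
    nlinarith
  · rw [not_le] at hfar
    have hG0 := dirichletRowSum_nonneg_near L hfar
    rw [abs_of_nonneg hG0]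
    -- `L|t| ≤ π` since `|t| < 2π/(2L+1)` and `2L ≤ 2L+1`
    have hnear : (L : ℝ) * |t| ≤ Real.pi := by
      rw [lt_div_iff₀ hM] at hfar
      nlinarith [abs_nonneg t, Real.pi_pos]
    have h := dirichletRowSum_lower_near L hnear
    have hπ2 : Real.pi ^ 2 ≤ 10 := by nlinarith [Real.pi_lt_d2, Real.pi_pos]
    have hc : 1 / 16 ≤ 2 / (3 * Real.pi ^ 2) := by
      rw [div_le_div_iff₀ (by norm_num) (by positivity)]
      nlinarith
    calc 1 / 16 * (2 * L + 1) * min ((L : ℝ) ^ 2 * t ^ 2) 1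
        ≤ 2 / (3 * Real.pi ^ 2) * (2 * L + 1) * ((L : ℝ) ^ 2 * t ^ 2) := by
          have hmin2 : min ((L : ℝ) ^ 2 * t ^ 2) 1 ≤ (L : ℝ) ^ 2 * t ^ 2 := min_le_left _ _
          have hpos : 0 ≤ 2 / (3 * Real.pi ^ 2) * (2 * L + 1) := by positivity
          calc 1 / 16 * (2 * L + 1) * min ((L : ℝ) ^ 2 * t ^ 2) 1
              ≤ 2 / (3 * Real.pi ^ 2) * (2 * L + 1) * min ((L : ℝ) ^ 2 * t ^ 2) 1 := by
                gcongr
            _ ≤ 2 / (3 * Real.pi ^ 2) * (2 * L + 1) * ((L : ℝ) ^ 2 * t ^ 2) :=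
                mul_le_mul_of_nonneg_left hmin2 hpos
      _ ≤ (2 * L + 1 : ℝ) - dirichletRowSum L t := h


/-! ## Part 2. The symbol of the punctured cube in closed form -/

/-- The sine row sum vanishes: `Σ_{m=-L}^{L} sin(m t) = 0` (`m ↦ -m`). [folklore] -/
theorem sum_Icc_neg_sin (L : ℕ) (t : ℝ) : ∑ m ∈ Finset.Icc (-(L : ℤ)) L, Real.sin (m * t) = 0 := by
  set S := ∑ m ∈ Finset.Icc (-(L : ℤ)) L, Real.sin (m * t) with hS
  have hneg : S = -S := by
    calc S = ∑ m ∈ Finset.Icc (-(L : ℤ)) L, Real.sin (((-m : ℤ) : ℝ) * t) := by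
          rw [hS]
          refine Finset.sum_nbij' (fun m => -m) (fun m => -m) ?_ ?_ (fun m _ => neg_neg m)
            (fun m _ => neg_neg m) (fun m _ => by rw [neg_neg])
          · intro m hm; rw [Finset.mem_Icc] at hm ⊢; omega
          · intro m hm; rw [Finset.mem_Icc] at hm ⊢; omega
      _ = -S := by
          rw [hS, ← Finset.sum_neg_distrib]
          refine Finset.sum_congr rfl fun m _ => ?_
          push_cast
          rw [neg_mul, Real.sin_neg]
  linarith

/-- One row in complex form: `Σ_{m=-L}^{L} e^{i m t} = G_L(t)`. [folklore] -/
theorem sum_Icc_cexp (L : ℕ) (t : ℝ) :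
    ∑ m ∈ Finset.Icc (-(L : ℤ)) L, Complex.exp ((((m : ℝ) * t : ℝ) : ℂ) * Complex.I) =
      (dirichletRowSum L t : ℂ) := by
  apply Complex.ext
  · rw [Complex.re_sum, Complex.ofReal_re, dirichletRowSum]
    exact Finset.sum_congr rfl fun m _ => Complex.exp_ofReal_mul_I_re _
  · rw [Complex.im_sum, Complex.ofReal_im]
    simp_rw [Complex.exp_ofReal_mul_I_im]
    exact sum_Icc_neg_sin L t

/-- The cube sum in complex form: `Σ_{y ∈ [-L,L]^d} e^{i k·y} = Π_j G_L(k_j)`. [folklore] -/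
theorem sum_box_cexp_kdot (L : ℕ) (k : Fin d → ℝ) :
    ∑ y ∈ box d L, Complex.exp (((kdot k y : ℝ) : ℂ) * Complex.I) =
      ∏ j, (dirichletRowSum L (k j) : ℂ) := by
  have hexp : ∀ y : Site d, Complex.exp (((kdot k y : ℝ) : ℂ) * Complex.I) =
      ∏ j, Complex.exp (((((y j : ℤ) : ℝ) * k j : ℝ) : ℂ) * Complex.I) := by
    intro y
    rw [← Complex.exp_sum]
    congr 1
    unfold kdot
    push_cast
    rw [Finset.sum_mul]
    exact Finset.sum_congr rfl fun j _ => by ring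
  simp_rw [hexp]
  rw [box, Finset.sum_prod_piFinset (Finset.Icc (-(L : ℤ)) L)
    (fun j (m : ℤ) => Complex.exp (((((m : ℝ)) * k j : ℝ) : ℂ) * Complex.I))]
  exact Finset.prod_congr rfl fun j _ => sum_Icc_cexp L (k j)

/-- **Product formula** `Σ_{y ∈ [-L,L]^d} cos(k·y) = Π_j G_L(k_j)`. [folklore] -/
theorem sum_box_cos_kdot (L : ℕ) (k : Fin d → ℝ) :
    ∑ y ∈ box d L, Real.cos (kdot k y) = ∏ j, dirichletRowSum L (k j) := by
  have h := congrArg Complex.re (sum_box_cexp_kdot (d := d) L k)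
  rw [Complex.re_sum, ← Complex.ofReal_prod, Complex.ofReal_re] at h
  simp_rw [Complex.exp_ofReal_mul_I_re] at h
  exact h

/-- The neighbourhood of the origin in the range-`L` graph is the punctured cube
`[-L,L]^d ∖ {0}`. [cite: Sakai2007, §1.2, (1.15) (uniformly spread-out interaction)] -/
theorem neighborFinset_zero_eq_erase_box (d L : ℕ) :
    (spreadOutGraph d L).neighborFinset 0 = (box d L).erase 0 := by
  ext y
  rw [SimpleGraph.mem_neighborFinset, spreadOutGraph_adj_iff, Finset.mem_erase, mem_box]
  constructor
  · rintro ⟨hne, h⟩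
    refine ⟨fun h0 => hne h0.symm, fun i => ?_⟩
    have := h i
    rw [Pi.zero_apply, zero_sub, abs_neg] at this
    exact abs_le.1 this
  · rintro ⟨hne, h⟩
    refine ⟨fun h0 => hne h0.symm, fun i => ?_⟩
    rw [Pi.zero_apply, zero_sub, abs_neg]
    exact abs_le.2 (h i)

/-- `N_L = (2L+1)^d - 1`. [cite: Sakai2007, §1.2, (1.15)] -/
theorem soCount_eq (d L : ℕ) : soCount d L = (2 * L + 1) ^ d - 1 := by
  rw [soCount, ← SimpleGraph.card_neighborFinset_eq_degree, neighborFinset_zero_eq_erase_box,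
    Finset.card_erase_of_mem (zero_mem_box d L), card_box]

/-- `N_L + 1 = (2L+1)^d` over `ℝ`. [cite: Sakai2007, §1.2, (1.15)] -/
theorem soCount_add_one (d L : ℕ) : (soCount d L : ℝ) + 1 = (2 * L + 1) ^ d := by
  have h1 : 1 ≤ (2 * L + 1) ^ d := Nat.one_le_pow _ _ (by omega)
  have h : soCount d L + 1 = (2 * L + 1) ^ d := by rw [soCount_eq]; omega
  exact_mod_cast h

/-- `L^d ≤ N_L` for `d ≥ 1`. [folklore] -/
theorem pow_le_soCount (hd : 1 ≤ d) (L : ℕ) : L ^ d ≤ soCount d L := by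
  rw [soCount_eq]
  have h1 : L ^ d < (L + 1) ^ d := Nat.pow_lt_pow_left (by omega) (by omega)
  have h2 : (L + 1) ^ d ≤ (2 * L + 1) ^ d := Nat.pow_le_pow_left (by omega) d
  omega

/-- **The symbol in closed form**: `D̂(k) = (Π_j G_L(k_j) - 1)/N_L`. [folklore] -/
theorem soSymbol_eq_prod (k : Fin d → ℝ) :
    soSymbol d L k = ((∏ j, dirichletRowSum L (k j)) - 1) / soCount d L := by
  unfold soSymbol
  have h1 : ∑ y ∈ (spreadOutGraph d L).neighborFinset 0, soStep d L y * Real.cos (kdot k y) =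
      ((soCount d L : ℝ))⁻¹ * ∑ y ∈ (spreadOutGraph d L).neighborFinset 0, Real.cos (kdot k y) := by
    rw [Finset.mul_sum]
    refine Finset.sum_congr rfl fun y hy => ?_
    rw [soStep, if_pos ((SimpleGraph.mem_neighborFinset _ _ _).1 hy)]
  rw [h1, neighborFinset_zero_eq_erase_box, Finset.sum_erase_eq_sub (zero_mem_box d L),
    sum_box_cos_kdot, kdot_zero_right, Real.cos_zero, div_eq_inv_mul]

/-- **`1 - D̂(k) = ((2L+1)^d - Π_j G_L(k_j))/N_L`** (`d, L ≥ 1`). [folklore] -/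
theorem one_sub_soSymbol_eq (hd : 1 ≤ d) (hL : 1 ≤ L) (k : Fin d → ℝ) :
    1 - soSymbol d L k = ((2 * L + 1 : ℝ) ^ d - ∏ j, dirichletRowSum L (k j)) / soCount d L := by
  have hN : (0 : ℝ) < soCount d L := by exact_mod_cast soCount_pos hd hL
  rw [soSymbol_eq_prod, eq_div_iff hN.ne', sub_mul, div_mul_cancel₀ _ hN.ne', one_mul,
    ← soCount_add_one]
  ring

/-! ## Part 3. The uniform infrared bound -/

/-- **Uniform infrared bound for the uniformly spread-out step distribution** (van der
Hofstad–Slade's Assumption D, lower bounds (Dbound1)–(Dbound2), for Sakai's punctured cube, with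
explicit constants valid for every `L ≥ 1`): for `k ∈ [-π,π]^d`,
`1 - D̂(k) ≥ (1/16) min(L²‖k‖²_∞, 1)`. Hara–van der Hofstad–Slade quote it as
"`1 - D̂(k) ≥ δ₂L²|k|²` (`|k| ≤ L⁻¹`), `1 - D̂(k) ≥ δ₃`" (§6.1). Route: the product formula and
`(2L+1)^d - Π_j G_L(k_j) ≥ (2L+1)^{d-1}((2L+1) - |G_L(k_{j₀})|)` at a coordinate `j₀` realising
`‖k‖_∞`, then the one-dimensional two-sided bound.
[cite: HaraHofstadSlade2003, §6.1 (the bounds on 1 - D̂ quoted from van der Hofstad–Slade)]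
[cite: VanderhofstadSlade2002, §1.2, Assumption D and Appendix A] -/
theorem infrared_lower_bound (hd : 1 ≤ d) (hL : 1 ≤ L) {k : Fin d → ℝ} (hk : k ∈ cube d) :
    1 / 16 * min ((L : ℝ) ^ 2 * ‖k‖ ^ 2) 1 ≤ 1 - soSymbol d L k := by
  haveI : Nonempty (Fin d) := ⟨⟨0, hd⟩⟩
  obtain ⟨j₀, -, hj₀⟩ :=
    Finset.exists_max_image Finset.univ (fun j => |k j|) Finset.univ_nonempty
  have hnorm : ‖k‖ = |k j₀| := by
    apply le_antisymm
    · exact (pi_norm_le_iff_of_nonneg (abs_nonneg _)).2 fun j => by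
        rw [Real.norm_eq_abs]; exact hj₀ j (Finset.mem_univ j)
    · have := norm_le_pi_norm k j₀
      rwa [Real.norm_eq_abs] at this
  have hkj : |k j₀| ≤ Real.pi := by
    have := hk j₀ (Set.mem_univ _)
    exact abs_le.2 ⟨this.1, this.2⟩
  set M : ℝ := 2 * L + 1 with hMdef
  have hM : 0 < M := by positivity
  have h1 := dirichletRowSum_two_sided hL hkj
  -- `|Π_j G_L(k_j)| ≤ |G_L(k_{j₀})| M^{d-1}`
  have hprod : |∏ j, dirichletRowSum L (k j)| ≤ |dirichletRowSum L (k j₀)| * M ^ (d - 1) := by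
    rw [Finset.abs_prod, ← Finset.mul_prod_erase Finset.univ _ (Finset.mem_univ j₀)]
    refine mul_le_mul_of_nonneg_left ?_ (abs_nonneg _)
    calc ∏ j ∈ Finset.univ.erase j₀, |dirichletRowSum L (k j)|
        ≤ ∏ j ∈ Finset.univ.erase j₀, M :=
          Finset.prod_le_prod (fun _ _ => abs_nonneg _) fun j _ => abs_dirichletRowSum_le L (k j)
      _ = M ^ (d - 1) := by
          rw [Finset.prod_const, Finset.card_erase_of_mem (Finset.mem_univ _), Finset.card_univ,
            Fintype.card_fin]
  have hMd : M ^ d = M ^ (d - 1) * M := by rw [← pow_succ, Nat.sub_add_cancel hd]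
  have key : 1 / 16 * M ^ d * min ((L : ℝ) ^ 2 * (k j₀) ^ 2) 1 ≤
      M ^ d - ∏ j, dirichletRowSum L (k j) := by
    have hle : ∏ j, dirichletRowSum L (k j) ≤ |dirichletRowSum L (k j₀)| * M ^ (d - 1) :=
      (le_abs_self _).trans hprod
    calc 1 / 16 * M ^ d * min ((L : ℝ) ^ 2 * (k j₀) ^ 2) 1
        = M ^ (d - 1) * (1 / 16 * (2 * L + 1) * min ((L : ℝ) ^ 2 * (k j₀) ^ 2) 1) := by
          rw [hMd]; ring
      _ ≤ M ^ (d - 1) * ((2 * L + 1 : ℝ) - |dirichletRowSum L (k j₀)|) :=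
          mul_le_mul_of_nonneg_left h1 (by positivity)
      _ = M ^ d - |dirichletRowSum L (k j₀)| * M ^ (d - 1) := by rw [hMd]; ring
      _ ≤ M ^ d - ∏ j, dirichletRowSum L (k j) := by linarith
  rw [one_sub_soSymbol_eq hd hL, hnorm, sq_abs]
  have hN : (0 : ℝ) < soCount d L := by exact_mod_cast soCount_pos hd hL
  have hNM : (soCount d L : ℝ) ≤ M ^ d := by
    have := soCount_add_one d L
    rw [← hMdef] at this  -- may be a no-op
    have h' : (soCount d L : ℝ) + 1 = M ^ d := by rw [hMdef]; exact_mod_cast soCount_add_one d L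
    linarith
  have hmin0 : 0 ≤ min ((L : ℝ) ^ 2 * (k j₀) ^ 2) 1 := le_min (by positivity) zero_le_one
  rw [le_div_iff₀ hN]
  calc 1 / 16 * min ((L : ℝ) ^ 2 * (k j₀) ^ 2) 1 * soCount d L
      ≤ 1 / 16 * min ((L : ℝ) ^ 2 * (k j₀) ^ 2) 1 * M ^ d := by gcongr
    _ = 1 / 16 * M ^ d * min ((L : ℝ) ^ 2 * (k j₀) ^ 2) 1 := by ring
    _ ≤ M ^ d - ∏ j, dirichletRowSum L (k j) := key

/-- Consequence: `1 - D̂(k) > 0` off the origin with an `L`-uniform lower bound `1/16` once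
`L‖k‖_∞ ≥ 1`. [cite: VanderhofstadSlade2002, §1.2, Assumption D (Dbound2)] -/
theorem one_sub_soSymbol_ge_of_le (hd : 1 ≤ d) (hL : 1 ≤ L) {k : Fin d → ℝ} (hk : k ∈ cube d)
    (h1 : 1 ≤ (L : ℝ) * ‖k‖) : 1 / 16 ≤ 1 - soSymbol d L k := by
  have h := infrared_lower_bound hd hL hk
  have hsq : 1 ≤ (L : ℝ) ^ 2 * ‖k‖ ^ 2 := by
    rw [← mul_pow]; exact one_le_pow₀ h1
  rwa [min_eq_right hsq, mul_one] at h



/-! ## Part 4. The uniform bound `S_1(x) ≤ δ_{0,x} + O(L^{-d})` -/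

section UniformBound

open Real
open Literature.Probability.Percolation (kdot_add kdot_neg)

/-- `D^{*1} = D`. [folklore] -/
theorem convPow_one (x : Site d) : convPow (soStep d L) 1 x = soStep d L x := by
  show latticeConv delta0 (soStep d L) x = _
  unfold latticeConv
  rw [tsum_eq_single 0]
  · simp
  · intro y hy
    rw [delta0_of_ne_zero hy, zero_mul]

/-- `D(x) ≤ 1/N_L`. [folklore] -/
theorem soStep_le_inv (x : Site d) : soStep d L x ≤ ((soCount d L : ℝ))⁻¹ := by
  unfold soStep
  split_ifs
  · exact le_rfl
  · positivity

/-- `D^{*2}(0) = Σ_y D(y)D(-y) ≤ 1/N_L`. [folklore] -/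
theorem convPow_two_zero_le : convPow (soStep d L) 2 0 ≤ ((soCount d L : ℝ))⁻¹ := by
  rw [convPow_succ_eq_sum 1 0]
  calc ∑ u ∈ (spreadOutGraph d L).neighborFinset 0, convPow (soStep d L) 1 u * soStep d L (0 - u)
      ≤ ∑ u ∈ (spreadOutGraph d L).neighborFinset 0, soStep d L u * ((soCount d L : ℝ))⁻¹ :=
        Finset.sum_le_sum fun u _ => by
          rw [convPow_one]
          exact mul_le_mul_of_nonneg_left (soStep_le_inv _) (soStep_nonneg u)
    _ = (∑ u ∈ (spreadOutGraph d L).neighborFinset 0, soStep d L u) * ((soCount d L : ℝ))⁻¹ := by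
        rw [Finset.sum_mul]
    _ ≤ 1 * ((soCount d L : ℝ))⁻¹ :=
        mul_le_mul_of_nonneg_right sum_soStep_le_one (by positivity)
    _ = ((soCount d L : ℝ))⁻¹ := one_mul _

/-- **Parseval for the step distribution**: `∫_{[-π,π]^d} D̂(k)² dk = (2π)^d D^{*2}(0) ≤ (2π)^d/N_L`
(the `n = 2`, `x = 0` instance of the Fourier representation of `D^{*n}`).
[cite: HaraHofstadSlade2003, §6.1 (∫ D̂² = Σ_y D(y)² = O(L^{-d}))] -/
theorem integral_soSymbol_sq_le :
    ∫ k in cube d, soSymbol d L k ^ 2 ≤ (2 * π) ^ d / soCount d L := by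
  have h := convPow_eq_integral (d := d) (L := L) 2 0
  simp only [kdot_zero_right, Real.cos_zero, mul_one] at h
  have hπ : (0 : ℝ) < (2 * π) ^ d := by positivity
  have h' : ∫ k in cube d, soSymbol d L k ^ 2 = (2 * π) ^ d * convPow (soStep d L) 2 0 := by
    rw [h, ← mul_assoc, mul_inv_cancel₀ hπ.ne', one_mul]
  rw [h', div_eq_mul_inv]
  exact mul_le_mul_of_nonneg_left convPow_two_zero_le hπ.le

/-- Partial sums of the tail of a geometric series: `|Σ_{n<M} t^{n+2}| ≤ 2t²/(1 - t)` for
`-1 ≤ t < 1`. [folklore] -/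
theorem abs_sum_range_pow_add_two_le {t : ℝ} (ht : -1 ≤ t) (ht1 : t < 1) (M : ℕ) :
    |∑ n ∈ Finset.range M, t ^ (n + 2)| ≤ 2 * (t ^ 2 / (1 - t)) := by
  have h1t : 0 < 1 - t := by linarith
  have hre : ∑ n ∈ Finset.range M, t ^ (n + 2) = t ^ 2 * ∑ n ∈ Finset.range M, t ^ n := by
    rw [Finset.mul_sum]
    exact Finset.sum_congr rfl fun n _ => by ring
  rw [hre, abs_mul, abs_pow, sq_abs]
  calc t ^ 2 * |∑ n ∈ Finset.range M, t ^ n| ≤ t ^ 2 * (2 / (1 - t)) :=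
        mul_le_mul_of_nonneg_left (abs_geom_sum_le ht ht1 M) (sq_nonneg t)
    _ = 2 * (t ^ 2 / (1 - t)) := by ring

/-- Off the origin, a Lebesgue-null set, every momentum of the cube is admissible (`d ≥ 1`).
[folklore] -/
theorem ae_ne_zero_restrict_cube (hd : 1 ≤ d) :
    ∀ᵐ k ∂((volume : Measure (Fin d → ℝ)).restrict (cube d)), k ≠ (0 : Fin d → ℝ) := by
  haveI : Nonempty (Fin d) := ⟨⟨0, hd⟩⟩
  rw [ae_iff]
  have hsub : {k : Fin d → ℝ | ¬k ≠ 0} ⊆ {0} := fun k hk => by simpa using hk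
  have hle : (volume.restrict (cube d)) {k : Fin d → ℝ | ¬k ≠ 0} ≤
      volume ({0} : Set (Fin d → ℝ)) :=
    (measure_mono hsub).trans (Measure.restrict_apply_le _ _)
  exact le_antisymm (hle.trans (measure_singleton _).le) bot_le

/-- `1/min(A, 1) ≤ 1 + 1/A` for `A > 0`. [folklore] -/
theorem inv_min_one_le {A : ℝ} (hA : 0 < A) : (min A 1)⁻¹ ≤ 1 + A⁻¹ := by
  rcases le_total A 1 with h | h
  · rw [min_eq_left h]; linarith
  · rw [min_eq_right h, inv_one]
    have : 0 ≤ A⁻¹ := inv_nonneg.2 hA.le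
    linarith

/-- `ε(k) ≤ (d/2)‖k‖²_∞` (from `1 - cos u ≤ u²/2`). [folklore] -/
theorem dispersion_le_norm_sq (k : Fin d → ℝ) : dispersion k ≤ (d : ℝ) / 2 * ‖k‖ ^ 2 := by
  unfold dispersion
  calc ∑ i, (1 - Real.cos (k i)) ≤ ∑ i : Fin d, ‖k‖ ^ 2 / 2 := by
        refine Finset.sum_le_sum fun i _ => ?_
        have h1 := one_sub_cos_le (k i)
        have h2 : (k i) ^ 2 ≤ ‖k‖ ^ 2 := by
          rw [← sq_abs]
          have := norm_le_pi_norm k i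
          rw [Real.norm_eq_abs] at this
          exact pow_le_pow_left₀ (abs_nonneg _) this 2
        linarith
    _ = (d : ℝ) / 2 * ‖k‖ ^ 2 := by
        rw [Finset.sum_const, Finset.card_univ, Fintype.card_fin, nsmul_eq_mul]; ring

/-- **Integrability of `D̂²/(1 - D̂)` on the Brillouin zone** (`d ≥ 3`, `L ≥ 1`): off the origin it is
`≤ 16(1 + ‖k‖⁻²_∞) ≤ 16 + 8d/ε(k)`, and `1/ε` is integrable in `d ≥ 3`.
[cite: HaraHofstadSlade2003, §6.1 (the integral of D̂²/(1 - D̂))] -/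
theorem integrableOn_symbSq_div (hd : 3 ≤ d) (hL : 1 ≤ L) :
    IntegrableOn (fun k => soSymbol d L k ^ 2 / (1 - soSymbol d L k)) (cube d) volume := by
  have hd1 : 1 ≤ d := by omega
  have hL1 : (1 : ℝ) ≤ L := by exact_mod_cast hL
  -- dominating function
  set h : (Fin d → ℝ) → ℝ := fun k => 16 + 8 * d * (1 / dispersion k) with hh
  have hdisp : IntegrableOn (fun k : Fin d → ℝ => 1 / dispersion k) (cube d) volume :=
    (integrable_indicator_iff (measurableSet_brillouin d)).1 (integrable_indicator_inv_dispersion (d := d) hd)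
  have hhint : IntegrableOn h (cube d) volume := by
    have hc : IntegrableOn (fun _ : Fin d → ℝ => (16 : ℝ)) (cube d) volume :=
      integrableOn_const ((isCompact_univ_pi fun _ => isCompact_Icc).measure_lt_top.ne)
    exact hc.add (hdisp.const_mul (8 * d))
  have hmeas : AEStronglyMeasurable (fun k => soSymbol d L k ^ 2 / (1 - soSymbol d L k))
      (volume.restrict (cube d)) :=
    ((continuous_soSymbol.measurable.pow_const 2).div
      (measurable_const.sub continuous_soSymbol.measurable)).aestronglyMeasurable
  refine Integrable.mono' hhint hmeas ?_
  filter_upwards [ae_ne_zero_restrict_cube hd1, self_mem_ae_restrict (measurableSet_brillouin d)]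
    with k hk0 hk
  have hlt := soSymbol_lt_one hd1 hL hk hk0
  have ha : 0 < 1 - soSymbol d L k := by linarith
  have hkpos : 0 < ‖k‖ := norm_pos_iff.2 hk0
  have hir := infrared_lower_bound hd1 hL hk
  have hmpos : 0 < min ((L : ℝ) ^ 2 * ‖k‖ ^ 2) 1 := lt_min (by positivity) one_pos
  have hs2 : soSymbol d L k ^ 2 ≤ 1 := by
    have := abs_soSymbol_le_one (d := d) (L := L) k
    rw [← sq_abs]; nlinarith [abs_nonneg (soSymbol d L k)]
  rw [Real.norm_eq_abs, abs_of_nonneg (div_nonneg (sq_nonneg _) ha.le)]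
  -- `s²/a ≤ 1/a ≤ 16/min ≤ 16(1 + 1/(L²‖k‖²)) ≤ 16(1 + 1/‖k‖²) ≤ 16 + 4d/ε`
  have hεpos : 0 < dispersion k := dispersion_pos_of_mem_brillouin hk hk0
  have hinvk : (‖k‖ ^ 2)⁻¹ ≤ (d : ℝ) / 2 * (1 / dispersion k) := by
    have hdle := dispersion_le_norm_sq k
    have hdpos : (0 : ℝ) < d := by exact_mod_cast (by omega : 0 < d)
    have h2 : 2 / d * dispersion k ≤ ‖k‖ ^ 2 := by
      rw [div_mul_eq_mul_div, div_le_iff₀ hdpos]; nlinarith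
    calc (‖k‖ ^ 2)⁻¹ ≤ (2 / d * dispersion k)⁻¹ := inv_anti₀ (by positivity) h2
      _ = (d : ℝ) / 2 * (1 / dispersion k) := by field_simp
  have hinvL : ((L : ℝ) ^ 2 * ‖k‖ ^ 2)⁻¹ ≤ (‖k‖ ^ 2)⁻¹ := by
    refine inv_anti₀ (by positivity) ?_
    have : (1 : ℝ) ≤ (L : ℝ) ^ 2 := one_le_pow₀ hL1
    nlinarith [sq_nonneg ‖k‖]
  calc soSymbol d L k ^ 2 / (1 - soSymbol d L k) ≤ 1 / (1 - soSymbol d L k) :=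
        div_le_div_of_nonneg_right hs2 ha.le
    _ ≤ 1 / (1 / 16 * min ((L : ℝ) ^ 2 * ‖k‖ ^ 2) 1) :=
        one_div_le_one_div_of_le (by positivity) hir
    _ = 16 * (min ((L : ℝ) ^ 2 * ‖k‖ ^ 2) 1)⁻¹ := by field_simp
    _ ≤ 16 * (1 + ((L : ℝ) ^ 2 * ‖k‖ ^ 2)⁻¹) :=
        mul_le_mul_of_nonneg_left (inv_min_one_le (by positivity)) (by norm_num)
    _ ≤ 16 * (1 + (d : ℝ) / 2 * (1 / dispersion k)) := by
        gcongr; exact hinvL.trans hinvk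
    _ = h k := by rw [hh]; ring

/-- **Fourier bound on the tail of the Green function**: for `d ≥ 3`, `L ≥ 1` and every `M`,
`Σ_{n<M} D^{*(n+2)}(x) ≤ (2π)^{-d} ∫_{[-π,π]^d} 2D̂²/(1 - D̂) dk`, by the Fourier representation of
`D^{*n}` and `|Σ_{n<M} D̂^{n+2}| ≤ 2D̂²/(1 - D̂)`.
[cite: HaraHofstadSlade2003, §6.1 (1/(1-D̂) = 1 + D̂ + D̂²/(1-D̂))] -/
theorem sum_range_convPow_add_two_le (hd : 3 ≤ d) (hL : 1 ≤ L) (x : Site d) (M : ℕ) :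
    ∑ n ∈ Finset.range M, convPow (soStep d L) (n + 2) x ≤
      ((2 * π) ^ d)⁻¹ * ∫ k in cube d, 2 * (soSymbol d L k ^ 2 / (1 - soSymbol d L k)) := by
  have hd1 : 1 ≤ d := by omega
  have hπ : (0 : ℝ) < ((2 * π) ^ d)⁻¹ := by positivity
  set F : (Fin d → ℝ) → ℝ := fun k =>
    (∑ n ∈ Finset.range M, soSymbol d L k ^ (n + 2)) * Real.cos (kdot k x) with hF
  have hFint : IntegrableOn F (cube d) volume := by
    refine ContinuousOn.integrableOn_compact (isCompact_univ_pi fun _ => isCompact_Icc) ?_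
    exact ((continuous_finsetSum _ fun n _ => continuous_soSymbol.pow (n + 2)).mul
      (Real.continuous_cos.comp (continuous_kdot_left x))).continuousOn
  have hsum : ∑ n ∈ Finset.range M, convPow (soStep d L) (n + 2) x =
      ((2 * π) ^ d)⁻¹ * ∫ k in cube d, F k := by
    simp_rw [convPow_eq_integral, ← Finset.mul_sum]
    congr 1
    rw [← integral_finsetSum _ fun n _ => integrableOn_soSymbol_pow_mul_cos (n + 2) x]
    refine integral_congr_ae (ae_of_all _ fun k => ?_)
    simp only [hF, Finset.sum_mul]
  rw [hsum]
  refine mul_le_mul_of_nonneg_left ?_ hπ.le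
  have hG : IntegrableOn (fun k => 2 * (soSymbol d L k ^ 2 / (1 - soSymbol d L k))) (cube d) volume :=
    (integrableOn_symbSq_div hd hL).const_mul 2
  have hbound : ∀ᵐ k ∂(volume.restrict (cube d)),
      ‖F k‖ ≤ 2 * (soSymbol d L k ^ 2 / (1 - soSymbol d L k)) := by
    filter_upwards [ae_ne_zero_restrict_cube hd1, self_mem_ae_restrict (measurableSet_brillouin d)]
      with k hk0 hk
    have hlt := soSymbol_lt_one hd1 hL hk hk0
    have hge : -1 ≤ soSymbol d L k := (abs_le.1 (abs_soSymbol_le_one k)).1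
    have h1 : 0 < 1 - soSymbol d L k := by linarith
    rw [Real.norm_eq_abs, hF]
    simp only
    rw [abs_mul]
    calc |∑ n ∈ Finset.range M, soSymbol d L k ^ (n + 2)| * |Real.cos (kdot k x)|
        ≤ 2 * (soSymbol d L k ^ 2 / (1 - soSymbol d L k)) * 1 :=
          mul_le_mul (abs_sum_range_pow_add_two_le hge hlt M) (Real.abs_cos_le_one _)
            (abs_nonneg _) (by positivity)
      _ = 2 * (soSymbol d L k ^ 2 / (1 - soSymbol d L k)) := mul_one _
  calc ∫ k in cube d, F k ≤ ‖∫ k in cube d, F k‖ := Real.le_norm_self _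
    _ ≤ ∫ k in cube d, ‖F k‖ := norm_integral_le_integral_norm _
    _ ≤ ∫ k in cube d, 2 * (soSymbol d L k ^ 2 / (1 - soSymbol d L k)) :=
        integral_mono_ae hFint.norm hG hbound

/-- The model integrand of the small-momentum region: `u ↦ 1{‖u‖_∞ < 1}/‖u‖²_∞` on `ℝ^d`
(value `0` at the origin). Its integral is the `L`-independent constant in the bound
`∫_{‖k‖ < 1/L} dk/(L²‖k‖²) = L^{-d} ∫ 1{‖u‖ < 1}/‖u‖² du`. [folklore] -/
def unitBallInvSq (d : ℕ) (u : Fin d → ℝ) : ℝ := if ‖u‖ < 1 then (‖u‖ ^ 2)⁻¹ else 0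

/-- `unitBallInvSq ≥ 0`. [folklore] -/
theorem unitBallInvSq_nonneg (u : Fin d → ℝ) : 0 ≤ unitBallInvSq d u := by
  unfold unitBallInvSq; split_ifs <;> positivity

/-- `unitBallInvSq` is measurable. [folklore] -/
theorem measurable_unitBallInvSq : Measurable (unitBallInvSq d) := by
  unfold unitBallInvSq
  refine Measurable.ite (measurableSet_lt measurable_norm measurable_const) ?_ measurable_const
  exact (measurable_norm.pow_const 2).inv

/-- **`1{‖u‖ < 1}/‖u‖²` is integrable on `ℝ^d` for `d ≥ 3`** (it is `≤ (d/2)·1_{[-π,π]^d}/ε(u)`).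
[folklore] -/
theorem integrable_unitBallInvSq (hd : 3 ≤ d) : Integrable (unitBallInvSq d) volume := by
  have hbound : ∀ u : Fin d → ℝ, ‖unitBallInvSq d u‖ ≤
      (d : ℝ) / 2 * (brillouin d).indicator (fun p => 1 / dispersion p) u := by
    intro u
    rw [Real.norm_eq_abs, abs_of_nonneg (unitBallInvSq_nonneg u)]
    unfold unitBallInvSq
    split_ifs with hu
    · have hmem : u ∈ brillouin d := by
        intro i _
        have h1 : |u i| ≤ ‖u‖ := by
          have := norm_le_pi_norm u i; rwa [Real.norm_eq_abs] at this
        have hπ3 := Real.pi_gt_three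
        constructor <;> [linarith [(abs_le.1 (h1.trans hu.le)).1]; linarith [(abs_le.1 (h1.trans hu.le)).2]]
      rw [Set.indicator_of_mem hmem]
      rcases eq_or_ne u 0 with rfl | hu0
      · simp only [norm_zero]
        rw [zero_pow two_ne_zero, inv_zero]
        have := dispersion_nonneg (0 : Fin d → ℝ)
        positivity
      · have hεpos : 0 < dispersion u := dispersion_pos_of_mem_brillouin hmem hu0
        have hkpos : 0 < ‖u‖ := norm_pos_iff.2 hu0
        have hdpos : (0 : ℝ) < d := by exact_mod_cast (by omega : 0 < d)
        have hdle := dispersion_le_norm_sq u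
        have h2 : 2 / d * dispersion u ≤ ‖u‖ ^ 2 := by
          rw [div_mul_eq_mul_div, div_le_iff₀ hdpos]; nlinarith
        calc (‖u‖ ^ 2)⁻¹ ≤ (2 / d * dispersion u)⁻¹ := inv_anti₀ (by positivity) h2
          _ = (d : ℝ) / 2 * (1 / dispersion u) := by field_simp
    · have : 0 ≤ (brillouin d).indicator (fun p => 1 / dispersion p) u := by
        refine Set.indicator_nonneg (fun p _ => ?_) u
        have := dispersion_nonneg p
        positivity
      positivity
  exact ((integrable_indicator_inv_dispersion (d := d) hd).const_mul ((d : ℝ) / 2)).mono'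
    measurable_unitBallInvSq.aestronglyMeasurable (ae_of_all _ hbound)

/-- **Scaling**: `∫ 1{L‖k‖ < 1}/(L²‖k‖²) dk = L^{-d} ∫ 1{‖u‖ < 1}/‖u‖² du` (`L > 0`), Mathlib's
`Measure.integral_comp_smul`. [folklore] -/
theorem integral_unitBallInvSq_smul {L : ℝ} (hL : 0 < L) :
    ∫ k : Fin d → ℝ, unitBallInvSq d (L • k) = (L ^ d)⁻¹ * ∫ u, unitBallInvSq d u := by
  rw [Measure.integral_comp_smul volume (unitBallInvSq d) L, Module.finrank_fin_fun, smul_eq_mul,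
    abs_of_nonneg (inv_nonneg.2 (pow_nonneg hL.le _))]

/-- **The pointwise splitting of `D̂²/(1 - D̂)`** off the origin of the cube (`d, L ≥ 1`):
`D̂²/(1 - D̂) ≤ 16 D̂² + 16 · 1{L‖k‖ < 1}/(L²‖k‖²)` — the case `L‖k‖_∞ ≥ 1` uses `1 - D̂ ≥ 1/16`,
the case `L‖k‖_∞ < 1` uses `1 - D̂ ≥ L²‖k‖²/16` and `D̂² ≤ 1`.
[cite: HaraHofstadSlade2003, §6.1 (splitting the k-integral at |k| = 1/L)] -/
theorem symbSq_div_le_split (hd : 1 ≤ d) (hL : 1 ≤ L) {k : Fin d → ℝ} (hk : k ∈ cube d)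
    (hk0 : k ≠ 0) :
    soSymbol d L k ^ 2 / (1 - soSymbol d L k) ≤
      16 * soSymbol d L k ^ 2 + 16 * unitBallInvSq d ((L : ℝ) • k) := by
  have hlt := soSymbol_lt_one hd hL hk hk0
  have ha : 0 < 1 - soSymbol d L k := by linarith
  have hkpos : 0 < ‖k‖ := norm_pos_iff.2 hk0
  have hL0 : (0 : ℝ) < L := by exact_mod_cast (by omega : 0 < L)
  have hir := infrared_lower_bound hd hL hk
  have hs2 : soSymbol d L k ^ 2 ≤ 1 := by
    have := abs_soSymbol_le_one (d := d) (L := L) k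
    rw [← sq_abs]; nlinarith [abs_nonneg (soSymbol d L k)]
  have hg0 : 0 ≤ unitBallInvSq d ((L : ℝ) • k) := unitBallInvSq_nonneg _
  have hnormL : ‖(L : ℝ) • k‖ = L * ‖k‖ := by rw [norm_smul, Real.norm_eq_abs, abs_of_pos hL0]
  by_cases hcase : 1 ≤ (L : ℝ) * ‖k‖
  · -- `a ≥ 1/16`
    have hsq : 1 ≤ (L : ℝ) ^ 2 * ‖k‖ ^ 2 := by rw [← mul_pow]; exact one_le_pow₀ hcase
    rw [min_eq_right hsq, mul_one] at hir
    calc soSymbol d L k ^ 2 / (1 - soSymbol d L k) ≤ soSymbol d L k ^ 2 / (1 / 16) :=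
          div_le_div_of_nonneg_left (sq_nonneg _) (by norm_num) hir
      _ = 16 * soSymbol d L k ^ 2 := by ring
      _ ≤ 16 * soSymbol d L k ^ 2 + 16 * unitBallInvSq d ((L : ℝ) • k) := by linarith
  · rw [not_le] at hcase
    have hsq : (L : ℝ) ^ 2 * ‖k‖ ^ 2 ≤ 1 := by
      rw [← mul_pow]; exact pow_le_one₀ (by positivity) hcase.le
    rw [min_eq_left hsq] at hir
    have hval : unitBallInvSq d ((L : ℝ) • k) = ((L : ℝ) ^ 2 * ‖k‖ ^ 2)⁻¹ := by
      unfold unitBallInvSq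
      rw [hnormL, if_pos hcase, mul_pow]
    have hm : 0 < (L : ℝ) ^ 2 * ‖k‖ ^ 2 := by positivity
    calc soSymbol d L k ^ 2 / (1 - soSymbol d L k) ≤ 1 / (1 - soSymbol d L k) :=
          div_le_div_of_nonneg_right hs2 ha.le
      _ ≤ 1 / (1 / 16 * ((L : ℝ) ^ 2 * ‖k‖ ^ 2)) := one_div_le_one_div_of_le (by positivity) hir
      _ = 16 * unitBallInvSq d ((L : ℝ) • k) := by rw [hval]; field_simp
      _ ≤ 16 * soSymbol d L k ^ 2 + 16 * unitBallInvSq d ((L : ℝ) • k) := by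
          nlinarith [sq_nonneg (soSymbol d L k)]

/-- **The `k`-integral is `O(L^{-d})`**: for `d ≥ 3`, `L ≥ 1`,
`∫_{[-π,π]^d} D̂²/(1 - D̂) dk ≤ 16(2π)^d/N_L + 16 I_d/L^d`, `I_d = ∫ 1{‖u‖ < 1}/‖u‖² du` — the
small-momentum region by the infrared bound and scaling, the rest by Parseval.
[cite: HaraHofstadSlade2003, §6.1 (both halves of the k-integral are O(L^{-d}))] -/
theorem integral_symbSq_div_le (hd : 3 ≤ d) (hL : 1 ≤ L) :
    ∫ k in cube d, soSymbol d L k ^ 2 / (1 - soSymbol d L k) ≤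
      16 * ((2 * π) ^ d / soCount d L) + 16 * (((L : ℝ) ^ d)⁻¹ * ∫ u, unitBallInvSq d u) := by
  have hd1 : 1 ≤ d := by omega
  have hL0 : (0 : ℝ) < L := by exact_mod_cast (by omega : 0 < L)
  -- integrability of the two majorants
  have hgL : Integrable (fun k : Fin d → ℝ => unitBallInvSq d ((L : ℝ) • k)) volume :=
    (integrable_unitBallInvSq hd).comp_smul hL0.ne'
  have hs2 : IntegrableOn (fun k => soSymbol d L k ^ 2) (cube d) volume :=
    ContinuousOn.integrableOn_compact (isCompact_univ_pi fun _ => isCompact_Icc)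
      (continuous_soSymbol.pow 2).continuousOn
  have hmaj : IntegrableOn
      (fun k => 16 * soSymbol d L k ^ 2 + 16 * unitBallInvSq d ((L : ℝ) • k)) (cube d) volume :=
    (hs2.const_mul 16).add (hgL.integrableOn.const_mul 16)
  have hle : ∫ k in cube d, soSymbol d L k ^ 2 / (1 - soSymbol d L k) ≤
      ∫ k in cube d, (16 * soSymbol d L k ^ 2 + 16 * unitBallInvSq d ((L : ℝ) • k)) := by
    refine integral_mono_ae (integrableOn_symbSq_div hd hL) hmaj ?_
    filter_upwards [ae_ne_zero_restrict_cube hd1, self_mem_ae_restrict (measurableSet_brillouin d)]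
      with k hk0 hk
    exact symbSq_div_le_split hd1 hL hk hk0
  refine hle.trans ?_
  rw [integral_add (hs2.const_mul 16) (hgL.integrableOn.const_mul 16), integral_const_mul,
    integral_const_mul]
  have h1 := integral_soSymbol_sq_le (d := d) (L := L)
  have h2 : ∫ k in cube d, unitBallInvSq d ((L : ℝ) • k) ≤
      ((L : ℝ) ^ d)⁻¹ * ∫ u, unitBallInvSq d u := by
    rw [← integral_unitBallInvSq_smul hL0]
    exact setIntegral_le_integral hgL (ae_of_all _ fun k => unitBallInvSq_nonneg _)
  linarith

/-- **Hara–van der Hofstad–Slade's uniform bound (6.1)** for Sakai's uniformly spread-out walk: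
for `d ≥ 3` there is `C = C(d)` with `S_1(x) ≤ δ_{0,x} + C L^{-d}` for ALL `L ≥ 1` and all
`x ∈ ℤ^d` — "`δ_{0,x} ≤ S_μ(x) ≤ δ_{0,x} + O(L^{-d})`, uniform in `μ ≤ 1` and `x`" (printed for `L`
large; here with explicit constants for every `L ≥ 1`). Proof as printed: `S_1 = δ + D + Σ_{n≥2} D^{*n}`,
`D ≤ N_L⁻¹ ≤ L^{-d}`, and the Fourier bound on the tail with the `O(L^{-d})` estimate of
`∫ D̂²/(1 - D̂)`. This is the `|x| ≤ L` half of Liu–Slade's Proposition 1.2 bound (1.10)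
(`LiuSlade2026_prop12_greenBound`); the `|x| > L` half is the Gaussian decay of `S_1`.
[cite: HaraHofstadSlade2003, §6, first display (uniform bound δ ≤ S_μ ≤ δ + O(L^{-d})) and §6.1 (its proof)]
[cite: LiuSlade2026, Proposition 1.2, (1.10)] -/
theorem soGreen_one_le_delta_add_uniform (hd : 3 ≤ d) :
    ∃ C : ℝ, 0 ≤ C ∧ ∀ L : ℕ, 1 ≤ L → ∀ x : Site d,
      soGreen d L 1 x ≤ delta0 x + C / (L : ℝ) ^ d := by
  have hd1 : 1 ≤ d := by omega
  set I : ℝ := ∫ u, unitBallInvSq d u with hI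
  have hI0 : 0 ≤ I := integral_nonneg fun u => unitBallInvSq_nonneg u
  have hπ : (0 : ℝ) < (2 * π) ^ d := by positivity
  refine ⟨33 + 32 * ((2 * π) ^ d)⁻¹ * I, by positivity, fun L hL x => ?_⟩
  have hL0 : (0 : ℝ) < L := by exact_mod_cast (by omega : 0 < L)
  have hLd : (0 : ℝ) < (L : ℝ) ^ d := by positivity
  have hN : (0 : ℝ) < soCount d L := by exact_mod_cast soCount_pos hd1 hL
  -- `1/N ≤ 1/L^d`
  have hNinv : ((soCount d L : ℝ))⁻¹ ≤ ((L : ℝ) ^ d)⁻¹ := by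
    refine inv_anti₀ hLd ?_
    exact_mod_cast pow_le_soCount hd1 L
  -- the series and its splitting
  have hS : Summable fun n => convPow (soStep d L) n x := summable_convPow hd hL x
  have hsplit : soGreen d L 1 x =
      (delta0 x + soStep d L x) + ∑' n, convPow (soStep d L) (n + 2) x := by
    have h := (hS.sum_add_tsum_nat_add 2).symm
    simp only [Finset.sum_range_succ, Finset.sum_range_zero, zero_add] at h
    rw [soGreen]
    simp only [one_pow, one_mul]
    rw [h, convPow_one]
    rfl
  -- the tail
  have htail : ∑' n, convPow (soStep d L) (n + 2) x ≤
      ((2 * π) ^ d)⁻¹ * ∫ k in cube d, 2 * (soSymbol d L k ^ 2 / (1 - soSymbol d L k)) :=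
    Real.tsum_le_of_sum_range_le (fun n => convPow_nonneg (n + 2) x)
      fun M => sum_range_convPow_add_two_le hd hL x M
  rw [integral_const_mul] at htail
  have hint := integral_symbSq_div_le hd hL
  have hstep : soStep d L x ≤ ((L : ℝ) ^ d)⁻¹ := (soStep_le_inv x).trans hNinv
  -- bookkeeping
  have hT : ∑' n, convPow (soStep d L) (n + 2) x ≤ (32 + 32 * ((2 * π) ^ d)⁻¹ * I) / (L : ℝ) ^ d := by
    calc ∑' n, convPow (soStep d L) (n + 2) x
        ≤ ((2 * π) ^ d)⁻¹ * (2 * ∫ k in cube d, soSymbol d L k ^ 2 / (1 - soSymbol d L k)) := htail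
      _ ≤ ((2 * π) ^ d)⁻¹ * (2 * (16 * ((2 * π) ^ d / soCount d L) +
            16 * (((L : ℝ) ^ d)⁻¹ * I))) := by gcongr
      _ = 32 * ((soCount d L : ℝ))⁻¹ + 32 * ((2 * π) ^ d)⁻¹ * I * ((L : ℝ) ^ d)⁻¹ := by
          field_simp; ring
      _ ≤ 32 * ((L : ℝ) ^ d)⁻¹ + 32 * ((2 * π) ^ d)⁻¹ * I * ((L : ℝ) ^ d)⁻¹ := by gcongr
      _ = (32 + 32 * ((2 * π) ^ d)⁻¹ * I) / (L : ℝ) ^ d := by field_simp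
  rw [hsplit]
  have : soStep d L x + ∑' n, convPow (soStep d L) (n + 2) x ≤
      (33 + 32 * ((2 * π) ^ d)⁻¹ * I) / (L : ℝ) ^ d := by
    rw [show (33 + 32 * ((2 * π) ^ d)⁻¹ * I) / (L : ℝ) ^ d =
      ((L : ℝ) ^ d)⁻¹ + (32 + 32 * ((2 * π) ^ d)⁻¹ * I) / (L : ℝ) ^ d by field_simp; ring]
    exact add_le_add hstep hT
  linarith

/-- The same bound for every `μ ∈ [0, 1]` (`S_μ ≤ S_1` termwise).
[cite: HaraHofstadSlade2003, §6, first display (uniform in μ ≤ 1 and x)] -/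
theorem soGreen_le_delta_add_uniform (hd : 3 ≤ d) :
    ∃ C : ℝ, 0 ≤ C ∧ ∀ L : ℕ, 1 ≤ L → ∀ μ : ℝ, 0 ≤ μ → μ ≤ 1 → ∀ x : Site d,
      soGreen d L μ x ≤ delta0 x + C / (L : ℝ) ^ d := by
  obtain ⟨C, hC, h⟩ := soGreen_one_le_delta_add_uniform (d := d) hd
  refine ⟨C, hC, fun L hL μ hμ0 hμ1 x => le_trans ?_ (h L hL x)⟩
  have hS : Summable fun n => convPow (soStep d L) n x := summable_convPow hd hL x
  have hle : ∀ n, μ ^ n * convPow (soStep d L) n x ≤ convPow (soStep d L) n x := fun n =>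
    mul_le_of_le_one_left (convPow_nonneg n x) (pow_le_one₀ hμ0 hμ1)
  have hnn : ∀ n, 0 ≤ μ ^ n * convPow (soStep d L) n x := fun n =>
    mul_nonneg (pow_nonneg hμ0 n) (convPow_nonneg n x)
  have hSμ : Summable fun n => μ ^ n * convPow (soStep d L) n x :=
    Summable.of_nonneg_of_le hnn hle hS
  rw [soGreen, soGreen]
  simp only [one_pow, one_mul]
  exact hSμ.tsum_le_tsum hle hS

end UniformBound


/-! ## Part 5. `D̂ > -1` and the Fourier representation of `S_μ` -/

section FourierRepresentation

open Real

/-- **`D̂` stays away from `-1`** (van der Hofstad–Slade's Assumption D, (Dbound3)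
`a_L(k) < 2 - η`, for the punctured cube with an explicit constant and every `d ≥ 2`, `L ≥ 1`):
`1 + D̂(k) ≥ 5/16` on `[-π,π]^d`. (A negative product `Π_j G_L(k_j)` has a negative factor, whose
coordinate satisfies `|k_j| ≥ 2π/(2L+1)`, so that factor is at most `(2L+1)/2` in modulus and
`Π_j G_L(k_j) ≥ -(2L+1)^d/2`; for `d = 1`, `L = 1` the bound fails: `D̂(k) = cos k`.)
[cite: VanderhofstadSlade2002, §1.2, Assumption D (Dbound3) and Appendix A] -/
theorem one_add_soSymbol_ge (hd : 2 ≤ d) (hL : 1 ≤ L) {k : Fin d → ℝ} (hk : k ∈ cube d) :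
    5 / 16 ≤ 1 + soSymbol d L k := by
  have hd1 : 1 ≤ d := by omega
  set M : ℝ := 2 * L + 1 with hMdef
  have hM : 0 < M := by positivity
  have hM3 : 3 ≤ M := by
    have : (1 : ℝ) ≤ L := by exact_mod_cast hL
    rw [hMdef]; linarith
  -- `Π_j G_L(k_j) ≥ -M^d/2`
  have hprod : -(M ^ d / 2) ≤ ∏ j, dirichletRowSum L (k j) := by
    by_cases hnn : ∀ j, 0 ≤ dirichletRowSum L (k j)
    · have : 0 ≤ ∏ j, dirichletRowSum L (k j) := Finset.prod_nonneg fun j _ => hnn j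
      have : 0 ≤ M ^ d / 2 := by positivity
      linarith
    · simp only [not_forall, not_le] at hnn
      obtain ⟨j₀, hj₀⟩ := hnn
      have hkj : |k j₀| ≤ Real.pi := by
        have := hk j₀ (Set.mem_univ _)
        exact abs_le.2 ⟨this.1, this.2⟩
      have hfar : 2 * Real.pi / (2 * L + 1) ≤ |k j₀| := by
        by_contra h
        rw [not_le] at h
        exact absurd (dirichletRowSum_nonneg_near L h) (not_le.2 hj₀)
      have hhalf := abs_dirichletRowSum_le_half L hkj hfar
      have habs : |∏ j, dirichletRowSum L (k j)| ≤ M ^ d / 2 := by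
        rw [Finset.abs_prod, ← Finset.mul_prod_erase Finset.univ _ (Finset.mem_univ j₀)]
        have h2 : ∏ j ∈ Finset.univ.erase j₀, |dirichletRowSum L (k j)| ≤ M ^ (d - 1) := by
          calc ∏ j ∈ Finset.univ.erase j₀, |dirichletRowSum L (k j)|
              ≤ ∏ j ∈ Finset.univ.erase j₀, M :=
                Finset.prod_le_prod (fun _ _ => abs_nonneg _) fun j _ => abs_dirichletRowSum_le L (k j)
            _ = M ^ (d - 1) := by
                rw [Finset.prod_const, Finset.card_erase_of_mem (Finset.mem_univ _), Finset.card_univ,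
                  Fintype.card_fin]
        have hMd : M ^ d = M ^ (d - 1) * M := by rw [← pow_succ, Nat.sub_add_cancel hd1]
        calc |dirichletRowSum L (k j₀)| * ∏ j ∈ Finset.univ.erase j₀, |dirichletRowSum L (k j)|
            ≤ (2 * L + 1) / 2 * M ^ (d - 1) :=
              mul_le_mul hhalf h2 (Finset.prod_nonneg fun _ _ => abs_nonneg _) (by positivity)
          _ = M ^ d / 2 := by rw [hMd, hMdef]; ring
      exact (abs_le.1 habs).1
  -- `1 + D̂ = (M^d - 2 + Π)/N ≥ (M^d/2 - 2)/(M^d - 1) ≥ 5/16`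
  have hN : (0 : ℝ) < soCount d L := by exact_mod_cast soCount_pos hd1 hL
  have hN1 : (soCount d L : ℝ) + 1 = M ^ d := by rw [hMdef]; exact_mod_cast soCount_add_one d L
  have hMd9 : 9 ≤ M ^ d := by
    calc (9 : ℝ) = 3 ^ 2 := by norm_num
      _ ≤ M ^ 2 := pow_le_pow_left₀ (by norm_num) hM3 2
      _ ≤ M ^ d := pow_le_pow_right₀ (by linarith) hd
  have heq : 1 + soSymbol d L k = ((soCount d L : ℝ) - 1 + ∏ j, dirichletRowSum L (k j)) / soCount d L := by
    rw [soSymbol_eq_prod, eq_div_iff hN.ne', add_mul, div_mul_cancel₀ _ hN.ne']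
    ring
  rw [heq, le_div_iff₀ hN]
  nlinarith

/-- `|D̂(k)| < 1` strictly inside `(-1, 1)` off the origin; with `μ ∈ [0,1]`, `|μD̂(k)| < 1` for
`k ≠ 0` in the cube (`d ≥ 2`, `L ≥ 1`). [folklore] -/
theorem abs_mul_soSymbol_lt_one (hd : 2 ≤ d) (hL : 1 ≤ L) {μ : ℝ} (hμ0 : 0 ≤ μ) (hμ1 : μ ≤ 1)
    {k : Fin d → ℝ} (hk : k ∈ cube d) (hk0 : k ≠ 0) : |μ * soSymbol d L k| < 1 := by
  have hlt := soSymbol_lt_one (by omega) hL hk hk0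
  have hgt : -1 < soSymbol d L k := by linarith [one_add_soSymbol_ge hd hL hk]
  rw [abs_lt]
  constructor
  · rcases le_or_gt 0 (soSymbol d L k) with hs | hs
    · nlinarith
    · nlinarith
  · rcases le_or_gt 0 (soSymbol d L k) with hs | hs
    · calc μ * soSymbol d L k ≤ 1 * soSymbol d L k := mul_le_mul_of_nonneg_right hμ1 hs
        _ < 1 := by linarith
    · nlinarith

/-- **The pointwise majorant of `1/(1 - D̂)`** off the origin of the cube (`d ≥ 1`, `L ≥ 1`):
`1/(1 - D̂(k)) ≤ 16(1 + ‖k‖⁻²_∞) ≤ 16 + 8d/ε(k)` (infrared bound, `1/min(A,1) ≤ 1 + 1/A`,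
`ε(k) ≤ (d/2)‖k‖²_∞`). [cite: HaraHofstadSlade2003, §6.1 (the k-integrals controlled by the infrared bound)] -/
theorem inv_one_sub_soSymbol_le (hd : 1 ≤ d) (hL : 1 ≤ L) {k : Fin d → ℝ} (hk : k ∈ cube d)
    (hk0 : k ≠ 0) : 1 / (1 - soSymbol d L k) ≤ 16 + 8 * d * (1 / dispersion k) := by
  have hL1 : (1 : ℝ) ≤ L := by exact_mod_cast hL
  have hlt := soSymbol_lt_one hd hL hk hk0
  have ha : 0 < 1 - soSymbol d L k := by linarith
  have hkpos : 0 < ‖k‖ := norm_pos_iff.2 hk0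
  have hir := infrared_lower_bound hd hL hk
  have hmpos : 0 < min ((L : ℝ) ^ 2 * ‖k‖ ^ 2) 1 := lt_min (by positivity) one_pos
  have hεpos : 0 < dispersion k := dispersion_pos_of_mem_brillouin hk hk0
  have hinvk : (‖k‖ ^ 2)⁻¹ ≤ (d : ℝ) / 2 * (1 / dispersion k) := by
    have hdle := dispersion_le_norm_sq k
    have hdpos : (0 : ℝ) < d := by exact_mod_cast (by omega : 0 < d)
    have h2 : 2 / d * dispersion k ≤ ‖k‖ ^ 2 := by
      rw [div_mul_eq_mul_div, div_le_iff₀ hdpos]; nlinarith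
    calc (‖k‖ ^ 2)⁻¹ ≤ (2 / d * dispersion k)⁻¹ := inv_anti₀ (by positivity) h2
      _ = (d : ℝ) / 2 * (1 / dispersion k) := by field_simp
  have hinvL : ((L : ℝ) ^ 2 * ‖k‖ ^ 2)⁻¹ ≤ (‖k‖ ^ 2)⁻¹ := by
    refine inv_anti₀ (by positivity) ?_
    have : (1 : ℝ) ≤ (L : ℝ) ^ 2 := one_le_pow₀ hL1
    nlinarith [sq_nonneg ‖k‖]
  calc 1 / (1 - soSymbol d L k) ≤ 1 / (1 / 16 * min ((L : ℝ) ^ 2 * ‖k‖ ^ 2) 1) :=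
        one_div_le_one_div_of_le (by positivity) hir
    _ = 16 * (min ((L : ℝ) ^ 2 * ‖k‖ ^ 2) 1)⁻¹ := by field_simp
    _ ≤ 16 * (1 + ((L : ℝ) ^ 2 * ‖k‖ ^ 2)⁻¹) :=
        mul_le_mul_of_nonneg_left (inv_min_one_le (by positivity)) (by norm_num)
    _ ≤ 16 * (1 + (d : ℝ) / 2 * (1 / dispersion k)) := by
        gcongr; exact hinvL.trans hinvk
    _ = 16 + 8 * d * (1 / dispersion k) := by ring

/-- **`1/(1 - D̂)` is integrable on the Brillouin zone** for `d ≥ 3`, `L ≥ 1` — the transience of the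
spread-out walk in Fourier form, with an `L`-uniform majorant. [cite: LiuSlade2026, §1.2.1, (1.7) (S_μ as a Fourier integral, d > 2)] -/
theorem integrableOn_inv_one_sub_soSymbol (hd : 3 ≤ d) (hL : 1 ≤ L) :
    IntegrableOn (fun k => 1 / (1 - soSymbol d L k)) (cube d) volume := by
  have hd1 : 1 ≤ d := by omega
  have hdisp : IntegrableOn (fun k : Fin d → ℝ => 1 / dispersion k) (cube d) volume :=
    (integrable_indicator_iff (measurableSet_brillouin d)).1
      (integrable_indicator_inv_dispersion (d := d) hd)
  have hhint : IntegrableOn (fun k : Fin d → ℝ => 16 + 8 * d * (1 / dispersion k)) (cube d) volume := by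
    have hc : IntegrableOn (fun _ : Fin d → ℝ => (16 : ℝ)) (cube d) volume :=
      integrableOn_const ((isCompact_univ_pi fun _ => isCompact_Icc).measure_lt_top.ne)
    exact hc.add (hdisp.const_mul (8 * d))
  have hmeas : AEStronglyMeasurable (fun k => 1 / (1 - soSymbol d L k)) (volume.restrict (cube d)) :=
    (measurable_const.div (measurable_const.sub continuous_soSymbol.measurable)).aestronglyMeasurable
  refine Integrable.mono' hhint hmeas ?_
  filter_upwards [ae_ne_zero_restrict_cube hd1, self_mem_ae_restrict (measurableSet_brillouin d)]
    with k hk0 hk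
  have hlt := soSymbol_lt_one hd1 hL hk hk0
  rw [Real.norm_eq_abs, abs_of_nonneg (div_nonneg zero_le_one (by linarith))]
  exact inv_one_sub_soSymbol_le hd1 hL hk hk0

/-- **The Fourier representation of the spread-out Green function** — the identification of the
tree's series `S_μ = Σ_n μⁿ D^{*n}` (`soGreen`, Sakai 2007, (1.19)) with the Fourier integral by which
Hara–van der Hofstad–Slade and Liu–Slade DEFINE it: for `d ≥ 3`, `L ≥ 1`, `μ ∈ [0,1]`, `x ∈ ℤ^d`,
`S_μ(x) = (2π)^{-d} ∫_{[-π,π]^d} cos(k·x)/(1 - μD̂(k)) dk` (dominated convergence of the partial sums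
`(2π)^{-d}∫ (Σ_{n<M}(μD̂)ⁿ) cos(k·x)`, majorant `2(1 + 1/(1 - D̂))`, pointwise geometric series for
`|μD̂| < 1` off the origin).
[cite: LiuSlade2026, §1.2.1, (1.6)–(1.7) (S_μ = ∫ e^{-ik·x}/(1 - μD̂(k)) dk/(2π)^d, d > 2)]
[cite: HaraHofstadSlade2003, §1.2 (S_1 as the inverse Fourier transform of 1/(1 - D̂))] -/
theorem soGreen_eq_integral (hd : 3 ≤ d) (hL : 1 ≤ L) {μ : ℝ} (hμ0 : 0 ≤ μ) (hμ1 : μ ≤ 1)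
    (x : Site d) :
    soGreen d L μ x =
      ((2 * π) ^ d)⁻¹ * ∫ k in cube d, Real.cos (kdot k x) / (1 - μ * soSymbol d L k) := by
  have hd1 : 1 ≤ d := by omega
  have hd2 : 2 ≤ d := by omega
  -- the partial sums as integrals
  set F : ℕ → (Fin d → ℝ) → ℝ := fun M k =>
    (∑ n ∈ Finset.range M, (μ * soSymbol d L k) ^ n) * Real.cos (kdot k x) with hF
  have hpart : ∀ M, ∑ n ∈ Finset.range M, μ ^ n * convPow (soStep d L) n x =
      ((2 * π) ^ d)⁻¹ * ∫ k in cube d, F M k := by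
    intro M
    have hterm : ∀ n, μ ^ n * convPow (soStep d L) n x =
        ((2 * π) ^ d)⁻¹ * ∫ k in cube d, (μ * soSymbol d L k) ^ n * Real.cos (kdot k x) := by
      intro n
      rw [convPow_eq_integral, ← mul_assoc, mul_comm (μ ^ n), mul_assoc, ← integral_const_mul]
      congr 1
      refine integral_congr_ae (ae_of_all _ fun k => ?_)
      simp only [mul_pow]; ring
    have hint : ∀ n, IntegrableOn (fun k => (μ * soSymbol d L k) ^ n * Real.cos (kdot k x))
        (cube d) volume := fun n =>
      ContinuousOn.integrableOn_compact (isCompact_univ_pi fun _ => isCompact_Icc)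
        (((continuous_const.mul continuous_soSymbol).pow n).mul
          (Real.continuous_cos.comp (continuous_kdot_left x))).continuousOn
    simp_rw [hterm, ← Finset.mul_sum]
    congr 1
    rw [← integral_finsetSum _ fun n _ => hint n]
    refine integral_congr_ae (ae_of_all _ fun k => ?_)
    simp only [hF, Finset.sum_mul]
  -- summability and the limit of the partial sums
  have hS : Summable fun n => convPow (soStep d L) n x := summable_convPow hd hL x
  have hSμ : Summable fun n => μ ^ n * convPow (soStep d L) n x :=
    Summable.of_nonneg_of_le (fun n => mul_nonneg (pow_nonneg hμ0 n) (convPow_nonneg n x))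
      (fun n => mul_le_of_le_one_left (convPow_nonneg n x) (pow_le_one₀ hμ0 hμ1)) hS
  have hlim1 : Tendsto (fun M => ∑ n ∈ Finset.range M, μ ^ n * convPow (soStep d L) n x) atTop
      (𝓝 (soGreen d L μ x)) := hSμ.hasSum.tendsto_sum_nat
  -- dominated convergence on the Fourier side
  have hFmeas : ∀ M, AEStronglyMeasurable (F M) (volume.restrict (cube d)) := fun M =>
    (Continuous.aestronglyMeasurable <|
      (continuous_finsetSum _ fun n _ => (continuous_const.mul continuous_soSymbol).pow n).mul
        (Real.continuous_cos.comp (continuous_kdot_left x)))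
  set bound : (Fin d → ℝ) → ℝ := fun k => 2 * (1 + 1 / (1 - soSymbol d L k)) with hbound
  have hbint : Integrable bound (volume.restrict (cube d)) := by
    have hc : IntegrableOn (fun _ : Fin d → ℝ => (1 : ℝ)) (cube d) volume :=
      integrableOn_const ((isCompact_univ_pi fun _ => isCompact_Icc).measure_lt_top.ne)
    exact (hc.add (integrableOn_inv_one_sub_soSymbol hd hL)).const_mul 2
  have hFbound : ∀ M, ∀ᵐ k ∂(volume.restrict (cube d)), ‖F M k‖ ≤ bound k := by
    intro M
    filter_upwards [ae_ne_zero_restrict_cube hd1, self_mem_ae_restrict (measurableSet_brillouin d)]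
      with k hk0 hk
    have hlt := soSymbol_lt_one hd1 hL hk hk0
    have ht := abs_mul_soSymbol_lt_one hd2 hL hμ0 hμ1 hk hk0
    have ht1 : μ * soSymbol d L k < 1 := (abs_lt.1 ht).2
    have htm1 : -1 ≤ μ * soSymbol d L k := (abs_lt.1 ht).1.le
    have h1s : 0 < 1 - soSymbol d L k := by linarith
    -- `1/(1 - μs) ≤ 1 + 1/(1 - s)`
    have hkey : 1 / (1 - μ * soSymbol d L k) ≤ 1 + 1 / (1 - soSymbol d L k) := by
      rcases le_or_gt 0 (soSymbol d L k) with hs | hs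
      · have hle : 1 - soSymbol d L k ≤ 1 - μ * soSymbol d L k := by
          nlinarith [mul_le_mul_of_nonneg_right hμ1 hs]
        have := one_div_le_one_div_of_le h1s hle
        have h0 : (0 : ℝ) ≤ 1 := zero_le_one
        linarith
      · have hle : (1 : ℝ) ≤ 1 - μ * soSymbol d L k := by nlinarith
        have := one_div_le_one_div_of_le one_pos hle
        rw [div_one] at this
        have h0 : 0 ≤ 1 / (1 - soSymbol d L k) := by positivity
        linarith
    rw [Real.norm_eq_abs, hF]
    simp only
    rw [abs_mul]
    calc |∑ n ∈ Finset.range M, (μ * soSymbol d L k) ^ n| * |Real.cos (kdot k x)|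
        ≤ 2 / (1 - μ * soSymbol d L k) * 1 :=
          mul_le_mul (abs_geom_sum_le htm1 ht1 M) (Real.abs_cos_le_one _) (abs_nonneg _)
            (div_nonneg zero_le_two (by linarith))
      _ = 2 * (1 / (1 - μ * soSymbol d L k)) := by ring
      _ ≤ bound k := by rw [hbound]; exact mul_le_mul_of_nonneg_left hkey zero_le_two
  have hFlim : ∀ᵐ k ∂(volume.restrict (cube d)),
      Tendsto (fun M => F M k) atTop (𝓝 (Real.cos (kdot k x) / (1 - μ * soSymbol d L k))) := by
    filter_upwards [ae_ne_zero_restrict_cube hd1, self_mem_ae_restrict (measurableSet_brillouin d)]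
      with k hk0 hk
    have ht := abs_mul_soSymbol_lt_one hd2 hL hμ0 hμ1 hk hk0
    have hgeo := (hasSum_geometric_of_abs_lt_one ht).tendsto_sum_nat
    have := hgeo.mul_const (Real.cos (kdot k x))
    rw [div_eq_mul_inv, mul_comm (Real.cos _)]
    simpa [hF] using this
  have hlim2 := tendsto_integral_of_dominated_convergence bound hFmeas hbint hFbound hFlim
  have hlim2' : Tendsto (fun M => ((2 * π) ^ d)⁻¹ * ∫ k in cube d, F M k) atTop
      (𝓝 (((2 * π) ^ d)⁻¹ * ∫ k in cube d, Real.cos (kdot k x) / (1 - μ * soSymbol d L k))) :=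
    hlim2.const_mul _
  simp_rw [← hpart] at hlim2'
  exact tendsto_nhds_unique hlim1 hlim2'

end FourierRepresentation

end Literature.Barriers.CriticalPhenomena.SpreadOutIsing

end
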